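import Summits.AtomisticToContinuum.HydrodynamicLimit.Theorems.OneFlightGossipEngineCollisionActivityTailsEnvelopePlumbing
import Summits.AtomisticToContinuum.HydrodynamicLimit.Theses.BGEndpointRigidity
import Literature.MathematicalPhysics.KineticTheory.HardSphereEulerProofs
import HarnessLib

/-!
# BR: the marginal envelope (A) of the evolved local Gibbs law from the Lanford envelope `LanfordEnvelopeR`
# (`stub_marginalEnvelopeLG_of_lanfordEnvelopeR`, crux stmt-AtomisticToContinuum-13481 `InformationPercolationEngine.CollisionRate`, line `Sketch`)

The crux `CollisionRate` (Enskog collision-rate law for deterministic hard spheres at fixed reduced density `σ` under local Gibbs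
data) is kernel-reduced to two hypotheses, (A) "marginal envelope of the evolved law" and T34 (local equilibrium).  This file proves
the registered bridge BR: (A) follows from the EXISTING crux item `Theses.BGEndpointRigidity.LanfordEnvelopeR` (stmt-13677), the
Lanford/BGSR Gaussian envelope `|f_N^{(s)}(t, Z_s)| ≤ C^s e^{-β E(Z_s)}` (a.e. `Z_s`, all `s`, `t ∈ [0, T]`, all `N`) of ALL
volume-marginals of the density `𝟙_D · (W_N ∘ Φ_{-t})` of the evolved local Gibbs law `(Φ_t)_# LG`,
`LG = localGibbsLaw σ a₀ u₀ θ₀ N (Φ N)`.  It is static measure theory, in three layers that the lead reuses separately: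

* (L1) `pairTriple_lintegral_le_of_labelLawEnvelope` (and its two halves): a LABEL-SET law envelope
  `∫ G(w ∘ ι) dμ ≤ C^m ∫ G e^{-β E_m} d(Haar ⊗ Leb)^{⊗ m}` (`LabelLawEnvelope μ C β` of `…EnvelopePlumbing`) gives, for distinct labels
  `i, j` (`i, j, k`), `∫ f(w_i, w_j) dμ ≤ (C (2π/β)^{3/2})² ∫ f d(Haar ⊗ N(0, β⁻¹))^{⊗ 2}` and the cubic analogue.  Ingredients: the
  Gaussian normalisation `e^{-β|v|²/2} = (2π/β)^{3/2} M_{1,0,β⁻¹}(v)` and `M_{1,u,θ} dv = N(u, θ)`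
  (`withDensity_localMaxwellian_eq_gaussMeasure`), the product of densities (`pi_withDensity_eq`, `prod_withDensity_right`), and the
  identification of `ν^{⊗ Fin 2}`, `ν^{⊗ Fin 3}` with `ν ⊗ ν`, `ν ⊗ (ν ⊗ ν)` (`measurePreserving_finTwoArrow`,
  `measurePreserving_piFinSuccAbove`).
* (L2) `pairTriple_lintegral_flow_le_of_labelEnvelopeOn`, `marginalEnvelope_of_envelopeOn`: from the envelope on a horizon
  (`EnvelopeOn`, via the landed `stub_labelEnvelopeOn : LabelEnvelopeFromEnvelope`) to (A) in the crux's shape, the flow pulled out of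
  the push-forward by `lintegral_map`; one constant `max ((C (2π/β)^{3/2})²) ((C (2π/β)^{3/2})³)`, `u = 0`, `θ = β⁻¹`, `N₀ = 0`.
* The registered stub: `σ₀ := min σ₀' 2⁻¹`, `C ↦ |C|` (so that `C ≥ 0`), horizon `T := τ`.

References: H. Spohn, *Large Scale Dynamics of Interacting Particles* (1991), Part I §2.3, §4; I. Gallagher, L. Saint-Raymond,
B. Texier, *From Newton to Boltzmann* (2013), Ch. 4–6 (the Gaussian envelope of the marginals); T. Bodineau, I. Gallagher,
L. Saint-Raymond, *The Brownian motion as the limit of a deterministic system of hard-spheres* (2016), Prop. 3.2/4.1.  Elementary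
measure theory and bookkeeping; recorded here.
-/

open scoped BigOperators Topology Classical MeasureTheory ProbabilityTheory InnerProductSpace ENNReal
open Filter Set Function MeasureTheory
open Literature.Analysis.FluidPDE Literature.MathematicalPhysics.KineticTheory

noncomputable section

namespace Summit.AtomisticToContinuum.HydrodynamicLimit.Theorems.CollisionRate

open Summit.AtomisticToContinuum.HydrodynamicLimit.Theorems.CollisionActivityTailsActivityDomination (Flow Cfg)
open Summit.AtomisticToContinuum.HydrodynamicLimit.Theorems.CollisionActivityTailsEnvelopePlumbing (EnvelopeOn LabelEnvelopeOn
  LabelLawEnvelope gaussTupleWeight measurable_gaussTupleWeight stub_labelEnvelopeOn)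

/-! ### §1 Gaussian normalisation of the tuple weight -/

/-- The kinetic Boltzmann factor is the normalised Maxwellian of temperature `β⁻¹` times its partition function:
`e^{-β|v|²/2} = (2π/β)^{3/2} M_{1,0,β⁻¹}(v)`. [folklore] -/
theorem exp_neg_kinetic_eq_mul_localMaxwellian {β : ℝ} (hβ : 0 < β) (v : V3) :
    Real.exp (-(β * (2⁻¹ * ‖v‖ ^ 2))) = (2 * Real.pi / β) ^ (3 / 2 : ℝ) * localMaxwellian 1 β⁻¹ (0 : V3) v := by
  have hZ : 0 < (2 * Real.pi / β) ^ (3 / 2 : ℝ) := Real.rpow_pos_of_pos (by positivity) _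
  simp only [localMaxwellian, finrank_euclideanSpace_fin, Nat.cast_ofNat, sub_zero, one_mul]
  have h1 : (2 * Real.pi * β⁻¹) ^ (-(3 : ℝ) / 2) = ((2 * Real.pi / β) ^ (3 / 2 : ℝ))⁻¹ := by
    rw [← div_eq_mul_inv, neg_div, Real.rpow_neg (by positivity)]
  have h2 : -‖v‖ ^ 2 / (2 * β⁻¹) = -(β * (2⁻¹ * ‖v‖ ^ 2)) := by
    field_simp
  rw [h1, h2, mul_inv_cancel_left₀ hZ.ne']

/-- The tuple Gaussian weight is `(2π/β)^{3m/2}` times the product of the normalised Maxwellians of the `m` velocities. [folklore] -/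
theorem gaussTupleWeight_eq_const_mul_prod {β : ℝ} (hβ : 0 < β) {m : ℕ} (q : Fin m → T3 × V3) :
    gaussTupleWeight β q = ENNReal.ofReal (((2 * Real.pi / β) ^ (3 / 2 : ℝ)) ^ m) *
      ∏ a, ENNReal.ofReal (localMaxwellian 1 β⁻¹ (0 : V3) (q a).2) := by
  have hZ : 0 ≤ (2 * Real.pi / β) ^ (3 / 2 : ℝ) := Real.rpow_nonneg (by positivity) _
  have hM : ∀ v : V3, 0 ≤ localMaxwellian 1 β⁻¹ (0 : V3) v := fun v =>
    localMaxwellian_nonneg zero_le_one (inv_pos.2 hβ).le _ _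
  unfold gaussTupleWeight
  rw [Finset.mul_sum, Finset.mul_sum, ← Finset.sum_neg_distrib, Real.exp_sum]
  simp_rw [exp_neg_kinetic_eq_mul_localMaxwellian hβ]
  rw [Finset.prod_mul_distrib, Finset.prod_const, Finset.card_univ, Fintype.card_fin,
    ENNReal.ofReal_mul (pow_nonneg hZ m), ENNReal.ofReal_prod_of_nonneg fun a _ => hM (q a).2]

/-- `M_{1,u,θ}(v) d(x,v) = Haar_{𝕋³} ⊗ N(u, θ)` on `𝕋³ × ℝ³` (`withDensity_localMaxwellian_eq_gaussMeasure`). [folklore] -/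
theorem withDensity_localMaxwellian_snd_eq_prod_gaussMeasure {θ : ℝ} (hθ : 0 < θ) (u : V3) :
    (volume : Measure (T3 × V3)).withDensity (fun z => ENNReal.ofReal (localMaxwellian 1 θ u z.2)) =
      (volume : Measure T3).prod (gaussMeasure u θ) := by
  rw [← withDensity_localMaxwellian_eq_gaussMeasure hθ u,
    prod_withDensity_right (continuous_localMaxwellian 1 θ u).measurable.ennreal_ofReal]
  rfl

/-- **Gaussian normalisation of the tuple weight**: for measurable `G ≥ 0` on `(𝕋³ × ℝ³)^m`,
`∫ G e^{-β E_m} d(Haar ⊗ Leb)^{⊗m} = (2π/β)^{3m/2} ∫ G d(Haar ⊗ N(0, β⁻¹))^{⊗m}` (`pi_withDensity_eq`). [folklore] -/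
theorem lintegral_mul_gaussTupleWeight_eq {β : ℝ} (hβ : 0 < β) (m : ℕ) {G : (Fin m → T3 × V3) → ℝ≥0∞} (hG : Measurable G) :
    ∫⁻ q, G q * gaussTupleWeight β q =
      ENNReal.ofReal (((2 * Real.pi / β) ^ (3 / 2 : ℝ)) ^ m) *
        ∫⁻ q, G q ∂(Measure.pi fun _ : Fin m => (volume : Measure T3).prod (gaussMeasure (0 : V3) β⁻¹)) := by
  haveI hY : SigmaFinite (volume : Measure (T3 × V3)) := inferInstance
  have hMm : Measurable fun z : T3 × V3 => ENNReal.ofReal (localMaxwellian 1 β⁻¹ (0 : V3) z.2) :=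
    ((continuous_localMaxwellian 1 β⁻¹ (0 : V3)).measurable.comp measurable_snd).ennreal_ofReal
  have hP : Measurable fun q : Fin m → T3 × V3 => ∏ a, ENNReal.ofReal (localMaxwellian 1 β⁻¹ (0 : V3) (q a).2) :=
    Finset.measurable_prod _ fun a _ => hMm.comp (measurable_pi_apply a)
  have h1 := withDensity_localMaxwellian_snd_eq_prod_gaussMeasure (inv_pos.2 hβ) (0 : V3)
  haveI : SigmaFinite ((volume : Measure (T3 × V3)).withDensity
      fun z => ENNReal.ofReal (localMaxwellian 1 β⁻¹ (0 : V3) z.2)) := by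
    rw [h1]; infer_instance
  have hpi : (Measure.pi fun _ : Fin m => (volume : Measure T3).prod (gaussMeasure (0 : V3) β⁻¹)) =
      (volume : Measure (Fin m → T3 × V3)).withDensity
        (fun q => ∏ a, ENNReal.ofReal (localMaxwellian 1 β⁻¹ (0 : V3) (q a).2)) := by
    rw [← h1, pi_withDensity_eq (fun _ : Fin m => (volume : Measure (T3 × V3))) (fun _ => hMm)
      (fun _ => inferInstance), ← volume_pi]
  calc ∫⁻ q, G q * gaussTupleWeight β q
      = ∫⁻ q, ENNReal.ofReal (((2 * Real.pi / β) ^ (3 / 2 : ℝ)) ^ m) *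
          ((∏ a, ENNReal.ofReal (localMaxwellian 1 β⁻¹ (0 : V3) (q a).2)) * G q) := by
        refine lintegral_congr fun q => ?_
        rw [gaussTupleWeight_eq_const_mul_prod hβ]
        ring
    _ = ENNReal.ofReal (((2 * Real.pi / β) ^ (3 / 2 : ℝ)) ^ m) *
          ∫⁻ q, (∏ a, ENNReal.ofReal (localMaxwellian 1 β⁻¹ (0 : V3) (q a).2)) * G q :=
        lintegral_const_mul _ (hP.mul hG)
    _ = ENNReal.ofReal (((2 * Real.pi / β) ^ (3 / 2 : ℝ)) ^ m) *
          ∫⁻ q, G q ∂((volume : Measure (Fin m → T3 × V3)).withDensity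
            (fun q => ∏ a, ENNReal.ofReal (localMaxwellian 1 β⁻¹ (0 : V3) (q a).2))) := by
        rw [lintegral_withDensity_eq_lintegral_mul _ hP hG]
        rfl
    _ = _ := by rw [hpi]

/-! ### §2 `Fin 2`- and `Fin 3`-indexed products versus binary products -/

/-- `∫ f(q₀, q₁) dν^{⊗ Fin 2} = ∫ f d(ν ⊗ ν)` (`measurePreserving_finTwoArrow`). [folklore] -/
theorem lintegral_pi_fin_two_eq_lintegral_prod {α : Type*} [MeasurableSpace α] (ν : Measure α) [SigmaFinite ν]
    {f : α × α → ℝ≥0∞} (hf : Measurable f) :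
    ∫⁻ q : Fin 2 → α, f (q 0, q 1) ∂(Measure.pi fun _ => ν) = ∫⁻ p, f p ∂(ν.prod ν) :=
  (measurePreserving_finTwoArrow ν).lintegral_comp hf

/-- `∫ f(q₀, q₁, q₂) dν^{⊗ Fin 3} = ∫ f d(ν ⊗ (ν ⊗ ν))` (`measurePreserving_piFinSuccAbove` at `0`, then `finTwoArrow`). [folklore] -/
theorem lintegral_pi_fin_three_eq_lintegral_prod {α : Type*} [MeasurableSpace α] (ν : Measure α) [SigmaFinite ν]
    {f : α × α × α → ℝ≥0∞} (hf : Measurable f) :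
    ∫⁻ q : Fin 3 → α, f (q 0, q 1, q 2) ∂(Measure.pi fun _ => ν) = ∫⁻ p, f p ∂(ν.prod (ν.prod ν)) := by
  have h1 := measurePreserving_piFinSuccAbove (fun _ : Fin 3 => ν) 0
  have h2 : MeasurePreserving (Prod.map id MeasurableEquiv.finTwoArrow)
      (ν.prod (Measure.pi fun _ : Fin 2 => ν)) (ν.prod (ν.prod ν)) :=
    (MeasurePreserving.id ν).prod (measurePreserving_finTwoArrow ν)
  rw [← (h2.comp h1).lintegral_comp hf]
  rfl

/-! ### §3 (L1) Pair and triple bounds from a label-set law envelope -/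

/-- Two distinct labels form an injective `2`-labelling. [folklore] -/
theorem injective_vecCons_two {n : ℕ} {i j : Fin n} (hij : i ≠ j) : Function.Injective ![i, j] := by
  intro a b hab
  fin_cases a <;> fin_cases b
  · rfl
  · exact absurd hab (by simpa using hij)
  · exact absurd hab (by simpa using hij.symm)
  · rfl

/-- Three pairwise distinct labels form an injective `3`-labelling. [folklore] -/
theorem injective_vecCons_three {n : ℕ} {i j k : Fin n} (hij : i ≠ j) (hik : i ≠ k) (hjk : j ≠ k) :
    Function.Injective ![i, j, k] := by
  intro a b hab
  fin_cases a <;> fin_cases b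
  · rfl
  · exact absurd hab (by simpa using hij)
  · exact absurd hab (by simpa using hik)
  · exact absurd hab (by simpa using hij.symm)
  · rfl
  · exact absurd hab (by simpa using hjk)
  · exact absurd hab (by simpa using hik.symm)
  · exact absurd hab (by simpa using hjk.symm)
  · rfl

/-- **(L1, pair)** Under a label-set law envelope with constants `(C, β)`, the joint law of two distinct labels is at most
`(C (2π/β)^{3/2})² · (Haar ⊗ N(0, β⁻¹))^{⊗2}`, as a `lintegral` inequality for every measurable `f ≥ 0`. [folklore] -/
theorem pair_lintegral_le_of_labelLawEnvelope {N : ℕ} {μ : Measure (Cfg N)} {C β : ℝ} (hC : 0 ≤ C) (hβ : 0 < β)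
    (h : LabelLawEnvelope μ C β) {i j : Fin (N + 1)} (hij : i ≠ j)
    {f : (T3 × V3) × (T3 × V3) → ℝ≥0∞} (hf : Measurable f) :
    ∫⁻ w, f (w i, w j) ∂μ ≤ ENNReal.ofReal ((C * (2 * Real.pi / β) ^ (3 / 2 : ℝ)) ^ 2) *
      ∫⁻ q, f q ∂(((volume : Measure T3).prod (gaussMeasure (0 : V3) β⁻¹)).prod
        ((volume : Measure T3).prod (gaussMeasure (0 : V3) β⁻¹))) := by
  have hG : Measurable fun q : Fin 2 → T3 × V3 => f (q 0, q 1) :=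
    hf.comp ((measurable_pi_apply 0).prodMk (measurable_pi_apply 1))
  have h2 := h 2 ⟨![i, j], injective_vecCons_two hij⟩ _ hG
  rw [lintegral_mul_gaussTupleWeight_eq hβ 2 hG, lintegral_pi_fin_two_eq_lintegral_prod _ hf, ← mul_assoc,
    ← ENNReal.ofReal_mul (pow_nonneg hC 2), ← mul_pow] at h2
  simpa using h2

/-- **(L1, triple)** Under a label-set law envelope with constants `(C, β)`, the joint law of three pairwise distinct labels is at
most `(C (2π/β)^{3/2})³ · (Haar ⊗ N(0, β⁻¹))^{⊗3}`, as a `lintegral` inequality for every measurable `f ≥ 0`. [folklore] -/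
theorem triple_lintegral_le_of_labelLawEnvelope {N : ℕ} {μ : Measure (Cfg N)} {C β : ℝ} (hC : 0 ≤ C) (hβ : 0 < β)
    (h : LabelLawEnvelope μ C β) {i j k : Fin (N + 1)} (hij : i ≠ j) (hik : i ≠ k) (hjk : j ≠ k)
    {f : (T3 × V3) × (T3 × V3) × (T3 × V3) → ℝ≥0∞} (hf : Measurable f) :
    ∫⁻ w, f (w i, w j, w k) ∂μ ≤ ENNReal.ofReal ((C * (2 * Real.pi / β) ^ (3 / 2 : ℝ)) ^ 3) *
      ∫⁻ q, f q ∂(((volume : Measure T3).prod (gaussMeasure (0 : V3) β⁻¹)).prod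
        (((volume : Measure T3).prod (gaussMeasure (0 : V3) β⁻¹)).prod
          ((volume : Measure T3).prod (gaussMeasure (0 : V3) β⁻¹)))) := by
  have hG : Measurable fun q : Fin 3 → T3 × V3 => f (q 0, q 1, q 2) :=
    hf.comp ((measurable_pi_apply 0).prodMk ((measurable_pi_apply 1).prodMk (measurable_pi_apply 2)))
  have h3 := h 3 ⟨![i, j, k], injective_vecCons_three hij hik hjk⟩ _ hG
  rw [lintegral_mul_gaussTupleWeight_eq hβ 3 hG, lintegral_pi_fin_three_eq_lintegral_prod _ hf, ← mul_assoc,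
    ← ENNReal.ofReal_mul (pow_nonneg hC 3), ← mul_pow] at h3
  simpa using h3

/-- **(L1)** Pair and triple `lintegral` bounds from a label-set law envelope, with the common shape of hypothesis (A) of the
crux (reference law `Haar ⊗ N(0, β⁻¹)`, constants `(C (2π/β)^{3/2})²` and `(C (2π/β)^{3/2})³`). [folklore] -/
theorem pairTriple_lintegral_le_of_labelLawEnvelope {N : ℕ} {μ : Measure (Cfg N)} {C β : ℝ} (hC : 0 ≤ C) (hβ : 0 < β)
    (h : LabelLawEnvelope μ C β) :
    (∀ i j : Fin (N + 1), i ≠ j → ∀ f : (T3 × V3) × (T3 × V3) → ℝ≥0∞, Measurable f →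
        ∫⁻ w, f (w i, w j) ∂μ ≤ ENNReal.ofReal ((C * (2 * Real.pi / β) ^ (3 / 2 : ℝ)) ^ 2) *
          ∫⁻ q, f q ∂(((volume : Measure T3).prod (gaussMeasure (0 : V3) β⁻¹)).prod
            ((volume : Measure T3).prod (gaussMeasure (0 : V3) β⁻¹)))) ∧
    (∀ i j k : Fin (N + 1), i ≠ j → i ≠ k → j ≠ k → ∀ f : (T3 × V3) × (T3 × V3) × (T3 × V3) → ℝ≥0∞, Measurable f →
        ∫⁻ w, f (w i, w j, w k) ∂μ ≤ ENNReal.ofReal ((C * (2 * Real.pi / β) ^ (3 / 2 : ℝ)) ^ 3) *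
          ∫⁻ q, f q ∂(((volume : Measure T3).prod (gaussMeasure (0 : V3) β⁻¹)).prod
            (((volume : Measure T3).prod (gaussMeasure (0 : V3) β⁻¹)).prod
              ((volume : Measure T3).prod (gaussMeasure (0 : V3) β⁻¹))))) :=
  ⟨fun _ _ hij _ hf => pair_lintegral_le_of_labelLawEnvelope hC hβ h hij hf,
    fun _ _ _ hij hik hjk _ hf => triple_lintegral_le_of_labelLawEnvelope hC hβ h hij hik hjk hf⟩

/-! ### §4 (L2) The marginal envelope of the evolved local Gibbs law from the envelope on a horizon -/

/-- **(L2, sharp constants)** A label-set envelope on the horizon `[0, τ]` gives, for every `N` and `t ∈ [0, τ]`, the pair and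
triple bounds for the evolved local Gibbs law `LG = localGibbsLaw σ a₀ u₀ θ₀ N (Φ N)` read through the flow `Φ_t`
(`lintegral_map`), with reference law `Haar ⊗ N(0, β⁻¹)` and constants `(C (2π/β)^{3/2})²`, `(C (2π/β)^{3/2})³`. [folklore] -/
theorem pairTriple_lintegral_flow_le_of_labelEnvelopeOn {a₀ θ₀ : T3 → ℝ} {u₀ : T3 → V3} {σ : ℝ}
    {Φ : (N : ℕ) → Flow σ N} {τ β C : ℝ} (hβ : 0 < β) (hC : 0 ≤ C)
    (hL : LabelEnvelopeOn σ a₀ θ₀ u₀ Φ τ β C) (N : ℕ) {t : ℝ} (ht : t ∈ Set.Icc 0 τ) :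
    (∀ i j : Fin (N + 1), i ≠ j → ∀ f : (T3 × V3) × (T3 × V3) → ℝ≥0∞, Measurable f →
        ∫⁻ z, f ((Φ N).flow t z i, (Φ N).flow t z j) ∂(localGibbsLaw σ a₀ u₀ θ₀ N (Φ N)) ≤
          ENNReal.ofReal ((C * (2 * Real.pi / β) ^ (3 / 2 : ℝ)) ^ 2) *
            ∫⁻ q, f q ∂(((volume : Measure T3).prod (gaussMeasure (0 : V3) β⁻¹)).prod
              ((volume : Measure T3).prod (gaussMeasure (0 : V3) β⁻¹)))) ∧
    (∀ i j k : Fin (N + 1), i ≠ j → i ≠ k → j ≠ k → ∀ f : (T3 × V3) × (T3 × V3) × (T3 × V3) → ℝ≥0∞, Measurable f →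
        ∫⁻ z, f ((Φ N).flow t z i, (Φ N).flow t z j, (Φ N).flow t z k) ∂(localGibbsLaw σ a₀ u₀ θ₀ N (Φ N)) ≤
          ENNReal.ofReal ((C * (2 * Real.pi / β) ^ (3 / 2 : ℝ)) ^ 3) *
            ∫⁻ q, f q ∂(((volume : Measure T3).prod (gaussMeasure (0 : V3) β⁻¹)).prod
              (((volume : Measure T3).prod (gaussMeasure (0 : V3) β⁻¹)).prod
                ((volume : Measure T3).prod (gaussMeasure (0 : V3) β⁻¹))))) := by
  have hlaw := hL N t ht
  refine ⟨fun i j hij f hf => ?_, fun i j k hij hik hjk f hf => ?_⟩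
  · have hm : Measurable fun w : Cfg N => f (w i, w j) :=
      hf.comp ((measurable_pi_apply i).prodMk (measurable_pi_apply j))
    have h := pair_lintegral_le_of_labelLawEnvelope hC hβ hlaw hij hf
    rwa [lintegral_map hm ((Φ N).measurable_flow t)] at h
  · have hm : Measurable fun w : Cfg N => f (w i, w j, w k) :=
      hf.comp ((measurable_pi_apply i).prodMk ((measurable_pi_apply j).prodMk (measurable_pi_apply k)))
    have h := triple_lintegral_le_of_labelLawEnvelope hC hβ hlaw hij hik hjk hf
    rwa [lintegral_map hm ((Φ N).measurable_flow t)] at h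

/-- **(L2)** For continuous positive profiles, `0 < σ < 1/2`, a flow family `Φ`, a horizon `τ` and envelope constants `β > 0`,
`C ≥ 0`: the marginal envelope `EnvelopeOn` of the transported density implies the marginal envelope (A) of the evolved local Gibbs
law in the crux's shape — one constant `max ((C (2π/β)^{3/2})²) ((C (2π/β)^{3/2})³)`, reference Gaussian `N(0, β⁻¹)`, `N₀ = 0`
(`stub_labelEnvelopeOn` and (L1)). [folklore] -/
theorem marginalEnvelope_of_envelopeOn {a₀ θ₀ : T3 → ℝ} {u₀ : T3 → V3}
    (ha : Continuous a₀) (hθ : Continuous θ₀) (hu : Continuous u₀) (ha0 : ∀ x, 0 < a₀ x) (hθ0 : ∀ x, 0 < θ₀ x)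
    {σ : ℝ} (hσ : 0 < σ) (hσ2 : σ < 2⁻¹) (Φ : (N : ℕ) → Flow σ N) {τ β C : ℝ} (hβ : 0 < β) (hC : 0 ≤ C)
    (hE : EnvelopeOn σ a₀ θ₀ u₀ Φ τ β C) :
    ∃ C' : ℝ, 0 ≤ C' ∧ ∃ u : V3, ∃ θ : ℝ, 0 < θ ∧ ∃ N₀ : ℕ, ∀ N : ℕ, N₀ ≤ N →
      ∀ t ∈ Set.Icc (0 : ℝ) τ,
        (∀ i j : Fin (N + 1), i ≠ j → ∀ f : (T3 × V3) × (T3 × V3) → ℝ≥0∞, Measurable f →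
          ∫⁻ z, f ((Φ N).flow t z i, (Φ N).flow t z j) ∂(localGibbsLaw σ a₀ u₀ θ₀ N (Φ N)) ≤
            ENNReal.ofReal C' * ∫⁻ q, f q ∂(((volume : Measure T3).prod (gaussMeasure u θ)).prod
              ((volume : Measure T3).prod (gaussMeasure u θ)))) ∧
        (∀ i j k : Fin (N + 1), i ≠ j → i ≠ k → j ≠ k → ∀ f : (T3 × V3) × (T3 × V3) × (T3 × V3) → ℝ≥0∞, Measurable f →
          ∫⁻ z, f ((Φ N).flow t z i, (Φ N).flow t z j, (Φ N).flow t z k) ∂(localGibbsLaw σ a₀ u₀ θ₀ N (Φ N)) ≤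
            ENNReal.ofReal C' * ∫⁻ q, f q ∂(((volume : Measure T3).prod (gaussMeasure u θ)).prod
              (((volume : Measure T3).prod (gaussMeasure u θ)).prod ((volume : Measure T3).prod (gaussMeasure u θ))))) := by
  obtain ⟨hLab, -⟩ := stub_labelEnvelopeOn a₀ θ₀ u₀ ha hθ hu ha0 hθ0 σ hσ hσ2 Φ τ β C hC hE
  refine ⟨max ((C * (2 * Real.pi / β) ^ (3 / 2 : ℝ)) ^ 2) ((C * (2 * Real.pi / β) ^ (3 / 2 : ℝ)) ^ 3),
    (sq_nonneg _).trans (le_max_left _ _), 0, β⁻¹, inv_pos.2 hβ, 0, fun N _ t ht => ?_⟩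
  obtain ⟨hP, hT⟩ := pairTriple_lintegral_flow_le_of_labelEnvelopeOn hβ hC hLab N ht
  exact ⟨fun i j hij f hf => (hP i j hij f hf).trans (mul_le_mul_left (ENNReal.ofReal_le_ofReal (le_max_left _ _)) _),
    fun i j k hij hik hjk f hf => (hT i j k hij hik hjk f hf).trans
      (mul_le_mul_left (ENNReal.ofReal_le_ofReal (le_max_right _ _)) _)⟩

/-! ### §5 The registered stub -/

/-- **BR · (A) from the Lanford envelope.** The crux item `BGEndpointRigidity.LanfordEnvelopeR` (the Lanford/BGSR Gaussian envelope
`|f_N^{(s)}(t)| ≤ C^s e^{-β E_s}` a.e. of ALL volume-marginals of the density `𝟙_D · (W_N ∘ Φ_{-t})` of the evolved local Gibbs law,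
`t ∈ [0, T]`) implies hypothesis (A) of the crux `CollisionRate`: the two- and three-particle labelled marginals of the evolved local
Gibbs law are dominated by `C' ×` the product reference law `(Haar ⊗ N(u, θ))^{⊗ k}`, uniformly in `t ∈ [0, τ]` and `N`. Static
measure theory: `C ↦ |C|`, `EnvelopeOn`, `stub_labelEnvelopeOn` (label-set envelope), Gaussian normalisation (L1)/(L2) with
`u = 0`, `θ = β⁻¹`, `σ₀ := min σ₀' 2⁻¹`. [folklore] -/
theorem stub_marginalEnvelopeLG_of_lanfordEnvelopeR :
    Summit.AtomisticToContinuum.HydrodynamicLimit.Theses.BGEndpointRigidity.LanfordEnvelopeR →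
    ∀ (a₀ θ₀ : T3 → ℝ) (u₀ : T3 → V3), Continuous a₀ → Continuous θ₀ → Continuous u₀ →
      (∀ x, 0 < a₀ x) → (∀ x, 0 < θ₀ x) → ∃ σ₀ : ℝ, 0 < σ₀ ∧ ∀ σ : ℝ, 0 < σ → σ < σ₀ →
      ∀ Φ : (N : ℕ) → HardSphereFlow (Torus.geometry (Fin 3)) (hsDiameter σ N) (N + 1),
      ∀ τ : ℝ, 0 < τ → ∃ C : ℝ, 0 ≤ C ∧ ∃ u : V3, ∃ θ : ℝ, 0 < θ ∧ ∃ N₀ : ℕ, ∀ N : ℕ, N₀ ≤ N →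
      ∀ t ∈ Set.Icc (0 : ℝ) τ,
        (∀ i j : Fin (N + 1), i ≠ j → ∀ f : (T3 × V3) × (T3 × V3) → ℝ≥0∞, Measurable f →
          ∫⁻ z, f ((Φ N).flow t z i, (Φ N).flow t z j) ∂(localGibbsLaw σ a₀ u₀ θ₀ N (Φ N)) ≤
            ENNReal.ofReal C * ∫⁻ q, f q ∂(((volume : Measure T3).prod (gaussMeasure u θ)).prod
              ((volume : Measure T3).prod (gaussMeasure u θ)))) ∧
        (∀ i j k : Fin (N + 1), i ≠ j → i ≠ k → j ≠ k → ∀ f : (T3 × V3) × (T3 × V3) × (T3 × V3) → ℝ≥0∞, Measurable f →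
          ∫⁻ z, f ((Φ N).flow t z i, (Φ N).flow t z j, (Φ N).flow t z k) ∂(localGibbsLaw σ a₀ u₀ θ₀ N (Φ N)) ≤
            ENNReal.ofReal C * ∫⁻ q, f q ∂(((volume : Measure T3).prod (gaussMeasure u θ)).prod
              (((volume : Measure T3).prod (gaussMeasure u θ)).prod ((volume : Measure T3).prod (gaussMeasure u θ))))) := by
  intro hL a₀ θ₀ u₀ ha hθ hu ha0 hθ0
  obtain ⟨σ₁, hσ₁, hL1⟩ := hL a₀ θ₀ u₀ ha hθ hu ha0 hθ0
  refine ⟨min σ₁ 2⁻¹, lt_min hσ₁ (by norm_num), fun σ hσ hσlt Φ τ hτ => ?_⟩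
  obtain ⟨β, C, hβ, hB⟩ := hL1 σ hσ (hσlt.trans_le (min_le_left _ _)) τ hτ
  have hE : EnvelopeOn σ a₀ θ₀ u₀ Φ τ β |C| := by
    intro N k r hr
    filter_upwards [hB N (Φ N) k r hr] with Zk hZ
    exact hZ.trans (mul_le_mul_of_nonneg_right ((le_abs_self _).trans_eq (abs_pow C k)) (Real.exp_pos _).le)
  exact marginalEnvelope_of_envelopeOn ha hθ hu ha0 hθ0 hσ (hσlt.trans_le (min_le_right _ _)) Φ hβ (abs_nonneg C) hE

end Summit.AtomisticToContinuum.HydrodynamicLimit.Theorems.CollisionRate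

end
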